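import Summits.NavierStokesRegularity.NavierStokesRegularity.Theorems.ExtremiserTransienceNearExtremalTransienceExtremiserLiouvilleNoAnalyticExtremalReduction
import HarnessLib

/-!
# Crux `ExtremiserTransience.NearExtremalTransience` (stmt-NavierStokesRegularity-21883), line `extremiser_liouville`,
# stub K1b — STRUCTURE OF THE RESIDUE: a «plateau at infinity» extremiser also touches the constraint at a FINITE point, anti-aligned with its far field

`--supports stmt-NavierStokesRegularity-21883` (helper).  Author: prover seat `ns-el-k1b` (g0).

After `…NoAnalyticExtremalFarFieldGap` and `…NoAnalyticExtremalReduction` the residue of K1b is the exclusion of analytic EXTENDED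
extremisers `w` (`|S(w)| = κ⋆·M·‖ω‖₂‖∇ω‖₂`, `‖w‖ ≤ M`) whose sup `M` is approached at infinity.  This file records what the free
constant shifts of the extended class (`ext_le_bound_of_shift`: `‖w + b‖_∞ ≥ M` for every `b`) force on such an object when it has
a far-field limit `c` with `‖c‖ = M` (`Tendsto w (cocompact) (𝓝 c)`):
* `exists_norm_sub_smul_ge` — for every `0 < t < 1` the shifted field `w − t·c` (far-field speed `(1−t)M < M`) still has sup `≥ M`,
  attained at a finite point `x_t`: `‖w x_t − t c‖ ≥ M`, hence `⟪w x_t, c⟫ ≤ t M²/2` and `‖w x_t‖ ≥ (1 − t) M`;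
* **`exists_contact_inner_nonpos_of_farLimit`** — letting `t → 0` (the `x_t` stay in the bounded region `{⟪w, c⟫ ≤ M²/2}`): there is
  a FINITE contact point `x*` with `‖w x*‖ = M` and `⟪w x*, c⟫ ≤ 0`.
So the top-speed set of such an extremiser is not only «at infinity in direction `c`»: it contains a finite point whose velocity makes
an obtuse angle with `c` (the extended analogue of the tree's half-space law `KStar.HalfSpace.halfSpaceFree_of_attained`, here a
three-line consequence of the freedom to add constants).  Consequently the residue splits into (b1) the GLOBAL plateau `‖w‖ ≡ M`
(analytic, so forced as soon as the finite contact set has an interior point) and (b2) a finite contact set with empty interior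
containing such an `x*`, together with the plateau at infinity and the Euler–Lagrange system `G ≡ 0` — both open.

WHAT THIS IS NOT: not K1b; K1b is a STATIC statement about analytic κ⋆-efficient fields; the crux NET, rung N0 and NS regularity stay OPEN — nothing here proves NS regularity. [folklore]
-/

noncomputable section

open Set Filter Topology MeasureTheory Metric
open scoped InnerProductSpace RealInnerProductSpace ENNReal NNReal ContDiff
open Literature.Analysis.FluidPDE

namespace Summit.NavierStokesRegularity.NavierStokesRegularity.Theorems

-- the problem directory repeats the summit name (`NavierStokesRegularity/NavierStokesRegularity`)
set_option linter.dupNamespace false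

namespace ExtremiserLiouville

variable {w : EuclideanSpace ℝ (Fin 3) → EuclideanSpace ℝ (Fin 3)} {c : EuclideanSpace ℝ (Fin 3)} {M : ℝ}

/-- Far-field limit ⇒ beyond some radius, `‖w x − c‖ < δ`. [folklore] -/
theorem exists_radius_of_farLimit (hlim : Tendsto w (cocompact (EuclideanSpace ℝ (Fin 3))) (𝓝 c)) {δ : ℝ} (hδ : 0 < δ) :
    ∃ R : ℝ, ∀ x : EuclideanSpace ℝ (Fin 3), R < ‖x‖ → ‖w x - c‖ < δ := by
  have hev : ∀ᶠ x in cocompact (EuclideanSpace ℝ (Fin 3)), ‖w x - c‖ < δ := by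
    have := (Metric.tendsto_nhds.1 hlim) δ hδ
    simpa [dist_eq_norm] using this
  obtain ⟨K, hK, hKsub⟩ := mem_cocompact.1 hev
  obtain ⟨R, hR⟩ := hK.isBounded.subset_closedBall 0
  refine ⟨R, fun x hx => hKsub fun hxK => ?_⟩
  have := hR hxK
  rw [mem_closedBall, dist_zero_right] at this
  linarith

/-- **The shifted sup is attained at a finite point.**  Under the extended sharp inequality, an extended extremiser `w` with far
limit `c`, `‖c‖ = M`, has for every `0 < t < 1` a point `x_t` with `‖w x_t − t·c‖ ≥ M` (free constant shifts: `ext_le_bound_of_shift`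
with `b = −t c`; the far field of `w − t c` has speed `(1−t)M < M`, so the sup `≥ M` lives on a compact set). [folklore] -/
theorem exists_norm_sub_smul_ge
    (hext : ∀ (w : EuclideanSpace ℝ (Fin 3) → EuclideanSpace ℝ (Fin 3)) (M B : ℝ), ContDiff ℝ (⊤ : ℕ∞) w → Literature.Analysis.FluidPDE.VectorCalculus.IsDivFree w → (∀ x, ‖w x‖ ≤ M) → (∀ x, ‖fderiv ℝ w x‖ ≤ B) → (∫⁻ x, ‖iteratedFDeriv ℝ 1 w x‖ₑ ^ 2 < ⊤) → (∫⁻ x, ‖iteratedFDeriv ℝ 2 w x‖ₑ ^ 2 < ⊤) → |∫ x, ⟪Literature.Analysis.FluidPDE.curl w x, fderiv ℝ w x (Literature.Analysis.FluidPDE.curl w x)⟫_ℝ| ≤ (sInf {κ : ℝ | (∀ (v : EuclideanSpace ℝ (Fin 3) → EuclideanSpace ℝ (Fin 3)) (M B : ℝ), ContDiff ℝ (⊤ : ℕ∞) v → Literature.Analysis.FluidPDE.VectorCalculus.IsDivFree v → (∀ x, ‖v x‖ ≤ M) → (∀ x, ‖fderiv ℝ v x‖ ≤ B) → (∫⁻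 x, ‖iteratedFDeriv ℝ 0 v x‖ₑ ^ 2 < ⊤) → (∫⁻ x, ‖iteratedFDeriv ℝ 1 v x‖ₑ ^ 2 < ⊤) → (∫⁻ x, ‖iteratedFDeriv ℝ 2 v x‖ₑ ^ 2 < ⊤) → |∫ x, ⟪Literature.Analysis.FluidPDE.curl v x, fderiv ℝ v x (Literature.Analysis.FluidPDE.curl v x)⟫_ℝ| ≤ κ * M * Real.sqrt (∫ x, ‖Literature.Analysis.FluidPDE.curl v x‖ ^ 2) * Real.sqrt (∫ x, Literature.Analysis.FluidPDE.frobeniusNormSq (fderiv ℝ (Literature.Analysis.FluidPDE.curl v) x)))}) * M * Real.sqrt (∫ x, ‖Literature.Analysis.FluidPDE.curl w x‖ ^ 2) * Real.sqrt (∫ x, Literature.Analysis.FluidPDE.frobeniusNormSq (fderiv ℝ (Literature.Analysis.FluidPDE.curl w) x)))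
    (hw : ContDiff ℝ ∞ w) (hdiv : VectorCalculus.IsDivFree w) {B : ℝ} (hB : ∀ x, ‖fderiv ℝ w x‖ ≤ B)
    (h1 : ∫⁻ x, ‖iteratedFDeriv ℝ 1 w x‖ₑ ^ 2 < ⊤) (h2 : ∫⁻ x, ‖iteratedFDeriv ℝ 2 w x‖ₑ ^ 2 < ⊤)
    (hpos : 0 < M * Real.sqrt (∫ x, ‖curl w x‖ ^ 2) * Real.sqrt (∫ x, frobeniusNormSq (fderiv ℝ (curl w) x)))
    (hatt : |∫ x, ⟪curl w x, fderiv ℝ w x (curl w x)⟫| = (sInf {κ : ℝ | (∀ (v : EuclideanSpace ℝ (Fin 3) → EuclideanSpace ℝ (Fin 3)) (M B : ℝ), ContDiff ℝ (⊤ : ℕ∞) v → Literature.Analysis.FluidPDE.VectorCalculus.IsDivFree v → (∀ x, ‖v x‖ ≤ M) → (∀ x, ‖fderiv ℝ v x‖ ≤ B) → (∫⁻ x, ‖iteratedFDeriv ℝ 0 v x‖ₑ ^ 2 < ⊤) → (∫⁻ x, ‖iteratedFDeriv ℝ 1 v x‖ₑ ^ 2 < ⊤) → (∫⁻ x, ‖iteratedFDeriv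 ℝ 2 v x‖ₑ ^ 2 < ⊤) → |∫ x, ⟪Literature.Analysis.FluidPDE.curl v x, fderiv ℝ v x (Literature.Analysis.FluidPDE.curl v x)⟫_ℝ| ≤ κ * M * Real.sqrt (∫ x, ‖Literature.Analysis.FluidPDE.curl v x‖ ^ 2) * Real.sqrt (∫ x, Literature.Analysis.FluidPDE.frobeniusNormSq (fderiv ℝ (Literature.Analysis.FluidPDE.curl v) x)))}) * M * Real.sqrt (∫ x, ‖curl w x‖ ^ 2) * Real.sqrt (∫ x, frobeniusNormSq (fderiv ℝ (curl w) x)))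
    (hlim : Tendsto w (cocompact (EuclideanSpace ℝ (Fin 3))) (𝓝 c)) (hcM : ‖c‖ = M)
    {t : ℝ} (ht0 : 0 < t) (ht1 : t < 1) :
    ∃ x : EuclideanSpace ℝ (Fin 3), M ≤ ‖w x - t • c‖ := by
  have hM : 0 < M := by
    have hZ := Real.sqrt_nonneg (∫ x, ‖curl w x‖ ^ 2)
    have hW := Real.sqrt_nonneg (∫ x, frobeniusNormSq (fderiv ℝ (curl w) x))
    by_contra h
    rw [not_lt] at h
    have : M * Real.sqrt (∫ x, ‖curl w x‖ ^ 2) * Real.sqrt (∫ x, frobeniusNormSq (fderiv ℝ (curl w) x)) ≤ 0 :=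
      mul_nonpos_of_nonpos_of_nonneg (mul_nonpos_of_nonpos_of_nonneg h hZ) hW
    linarith
  -- no bound `< M` is possible for `w - t c`
  have hnb : ∀ M'' : ℝ, (∀ x, ‖w x - t • c‖ ≤ M'') → M ≤ M'' := by
    intro M'' hM''
    refine ext_le_bound_of_shift hext hw hdiv hB h1 h2 hpos hatt (-(t • c)) (M'' := M'') fun x => ?_
    rw [← sub_eq_add_neg]; exact hM'' x
  -- the far field of `w - t c` has speed `< (1 - t/2) M`
  obtain ⟨R, hR⟩ := exists_radius_of_farLimit hlim (show 0 < t * M / 2 by positivity)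
  have hfar : ∀ x : EuclideanSpace ℝ (Fin 3), R < ‖x‖ → ‖w x - t • c‖ < (1 - t / 2) * M := by
    intro x hx
    have h := hR x hx
    calc ‖w x - t • c‖ = ‖(w x - c) + (1 - t) • c‖ := by congr 1; rw [sub_smul, one_smul]; abel
      _ ≤ ‖w x - c‖ + ‖(1 - t) • c‖ := norm_add_le _ _
      _ < t * M / 2 + (1 - t) * M := by
          rw [norm_smul, Real.norm_eq_abs, abs_of_pos (by linarith), hcM]; linarith
      _ = (1 - t / 2) * M := by ring
  -- the sup over the compact ball
  set K : Set (EuclideanSpace ℝ (Fin 3)) := closedBall 0 (max R 0) with hKdef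
  have hKc : IsCompact K := isCompact_closedBall _ _
  have hKne : K.Nonempty := ⟨0, by simp [hKdef]⟩
  have hcont : Continuous fun x => ‖w x - t • c‖ := (hw.continuous.sub continuous_const).norm
  obtain ⟨x₀, hx₀K, hmax⟩ := hKc.exists_isMaxOn hKne hcont.continuousOn
  refine ⟨x₀, ?_⟩
  by_contra hlt
  rw [not_le] at hlt
  -- then `max (‖w x₀ - t c‖) ((1 - t/2) M) < M` bounds `w - t c` everywhere: contradiction with `hnb`
  set M'' := max ‖w x₀ - t • c‖ ((1 - t / 2) * M) with hM''
  have hM''lt : M'' < M := max_lt hlt (by nlinarith)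
  have hbound : ∀ x, ‖w x - t • c‖ ≤ M'' := by
    intro x
    by_cases hx : x ∈ K
    · exact (hmax hx).trans (le_max_left _ _)
    · have hx' : R < ‖x‖ := by
        rw [hKdef, mem_closedBall, dist_zero_right, not_le] at hx
        exact lt_of_le_of_lt (le_max_left _ _) hx
      exact (hfar x hx').le.trans (le_max_right _ _)
  linarith [hnb M'' hbound]

/-- **A finite, anti-aligned contact point.**  Under the extended sharp inequality, an extended extremiser `w` (`‖w‖ ≤ M`,
`|S(w)| = κ⋆M‖ω‖₂‖∇ω‖₂`, `M‖ω‖₂‖∇ω‖₂ > 0`) with far-field limit `c`, `‖c‖ = M` — the «plateau at infinity» — has a point `x*` with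
`‖w x*‖ = M` and `⟪w x*, c⟫ ≤ 0`.  (From `exists_norm_sub_smul_ge`: `‖w x_t − tc‖ ≥ M` forces `⟪w x_t, c⟫ ≤ tM²/2` and
`‖w x_t‖ ≥ (1−t)M`; the `x_t` stay where `⟪w, c⟫ ≤ M²/2`, a bounded set by the far limit; extract a convergent subsequence as
`t = 1/(n+2) → 0`.) [folklore] -/
theorem exists_contact_inner_nonpos_of_farLimit
    (hext : ∀ (w : EuclideanSpace ℝ (Fin 3) → EuclideanSpace ℝ (Fin 3)) (M B : ℝ), ContDiff ℝ (⊤ : ℕ∞) w → Literature.Analysis.FluidPDE.VectorCalculus.IsDivFree w → (∀ x, ‖w x‖ ≤ M) → (∀ x, ‖fderiv ℝ w x‖ ≤ B) → (∫⁻ x, ‖iteratedFDeriv ℝ 1 w x‖ₑ ^ 2 < ⊤) → (∫⁻ x, ‖iteratedFDeriv ℝ 2 w x‖ₑ ^ 2 < ⊤) → |∫ x, ⟪Literature.Analysis.FluidPDE.curl w x, fderiv ℝ w x (Literature.Analysis.FluidPDE.curl w x)⟫_ℝ| ≤ (sInf {κ : ℝ | (∀ (v : EuclideanSpace ℝ (Fin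 3) → EuclideanSpace ℝ (Fin 3)) (M B : ℝ), ContDiff ℝ (⊤ : ℕ∞) v → Literature.Analysis.FluidPDE.VectorCalculus.IsDivFree v → (∀ x, ‖v x‖ ≤ M) → (∀ x, ‖fderiv ℝ v x‖ ≤ B) → (∫⁻ x, ‖iteratedFDeriv ℝ 0 v x‖ₑ ^ 2 < ⊤) → (∫⁻ x, ‖iteratedFDeriv ℝ 1 v x‖ₑ ^ 2 < ⊤) → (∫⁻ x, ‖iteratedFDeriv ℝ 2 v x‖ₑ ^ 2 < ⊤) → |∫ x, ⟪Literature.Analysis.FluidPDE.curl v x, fderiv ℝ v x (Literature.Analysis.FluidPDE.curl v x)⟫_ℝ| ≤ κ * M * Real.sqrt (∫ x, ‖Literature.Analysis.FluidPDE.curl v x‖ ^ 2) * Real.sqrt (∫ x, Literature.Analysis.FluidPDE.frobeniusNormSq (fderiv ℝ (Literature.Analysis.FluidPDE.curl v) x)))}) * M * Real.sqrt (∫ x, ‖Literature.Analysis.FluidPDE.curl w x‖ ^ 2) * Real.sqrt (∫ x, Literature.Analysis.FluidPDE.frobeniusNormSq (fderiv ℝ (Literature.Analysis.FluidPDE.curl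 w) x)))
    (hw : ContDiff ℝ ∞ w) (hdiv : VectorCalculus.IsDivFree w) {B : ℝ} (hwM : ∀ x, ‖w x‖ ≤ M) (hB : ∀ x, ‖fderiv ℝ w x‖ ≤ B)
    (h1 : ∫⁻ x, ‖iteratedFDeriv ℝ 1 w x‖ₑ ^ 2 < ⊤) (h2 : ∫⁻ x, ‖iteratedFDeriv ℝ 2 w x‖ₑ ^ 2 < ⊤)
    (hpos : 0 < M * Real.sqrt (∫ x, ‖curl w x‖ ^ 2) * Real.sqrt (∫ x, frobeniusNormSq (fderiv ℝ (curl w) x)))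
    (hatt : |∫ x, ⟪curl w x, fderiv ℝ w x (curl w x)⟫| = (sInf {κ : ℝ | (∀ (v : EuclideanSpace ℝ (Fin 3) → EuclideanSpace ℝ (Fin 3)) (M B : ℝ), ContDiff ℝ (⊤ : ℕ∞) v → Literature.Analysis.FluidPDE.VectorCalculus.IsDivFree v → (∀ x, ‖v x‖ ≤ M) → (∀ x, ‖fderiv ℝ v x‖ ≤ B) → (∫⁻ x, ‖iteratedFDeriv ℝ 0 v x‖ₑ ^ 2 < ⊤) → (∫⁻ x, ‖iteratedFDeriv ℝ 1 v x‖ₑ ^ 2 < ⊤) → (∫⁻ x, ‖iteratedFDeriv ℝ 2 v x‖ₑ ^ 2 < ⊤) → |∫ x, ⟪Literature.Analysis.FluidPDE.curl v x, fderiv ℝ v x (Literature.Analysis.FluidPDE.curl v x)⟫_ℝ| ≤ κ * M * Real.sqrt (∫ x, ‖Literature.Analysis.FluidPDE.curl v x‖ ^ 2) * Real.sqrt (∫ x, Literature.Analysis.FluidPDE.frobeniusNormSq (fderiv ℝ (Literature.Analysis.FluidPDE.curl v) x)))}) * M * Real.sqrt (∫ x, ‖curl w x‖ ^ 2) * Real.sqrt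 (∫ x, frobeniusNormSq (fderiv ℝ (curl w) x)))
    (hlim : Tendsto w (cocompact (EuclideanSpace ℝ (Fin 3))) (𝓝 c)) (hcM : ‖c‖ = M) :
    ∃ x : EuclideanSpace ℝ (Fin 3), ‖w x‖ = M ∧ ⟪w x, c⟫ ≤ 0 := by
  have hM0 : 0 ≤ M := (norm_nonneg _).trans (hwM 0)
  -- the points x_n for t_n = 1/(n+2)
  set t : ℕ → ℝ := fun n => 1 / ((n : ℝ) + 2) with htdef
  have ht0 : ∀ n, 0 < t n := fun n => by rw [htdef]; positivity
  have ht1 : ∀ n, t n < 1 := fun n => by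
    rw [htdef]; rw [div_lt_one (by positivity)]; linarith [Nat.cast_nonneg (α := ℝ) n]
  have hthalf : ∀ n, t n ≤ 1 / 2 := fun n => by
    rw [htdef]; rw [div_le_div_iff₀ (by positivity) (by norm_num)]; linarith [Nat.cast_nonneg (α := ℝ) n]
  have hx : ∀ n, ∃ x : EuclideanSpace ℝ (Fin 3), M ≤ ‖w x - t n • c‖ := fun n =>
    exists_norm_sub_smul_ge hext hw hdiv hB h1 h2 hpos hatt hlim hcM (ht0 n) (ht1 n)
  choose x hxM using hx
  -- consequences of `‖w x_n - t_n c‖ ≥ M`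
  have hinner : ∀ n, ⟪w (x n), c⟫ ≤ t n * M ^ 2 / 2 := by
    intro n
    have h := hxM n
    have hsq : M ^ 2 ≤ ‖w (x n) - t n • c‖ ^ 2 := pow_le_pow_left₀ hM0 h 2
    rw [@norm_sub_sq_real, norm_smul, Real.norm_eq_abs, abs_of_pos (ht0 n), hcM, inner_smul_right] at hsq
    have hw2 : ‖w (x n)‖ ^ 2 ≤ M ^ 2 := pow_le_pow_left₀ (norm_nonneg _) (hwM _) 2
    have htn := ht0 n
    nlinarith
  have hnorm : ∀ n, (1 - t n) * M ≤ ‖w (x n)‖ := by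
    intro n
    have h := hxM n
    calc (1 - t n) * M = M - t n * M := by ring
      _ ≤ ‖w (x n) - t n • c‖ - ‖t n • c‖ := by
          rw [norm_smul, Real.norm_eq_abs, abs_of_pos (ht0 n), hcM]; linarith
      _ ≤ ‖w (x n)‖ := by linarith [norm_sub_le (w (x n)) (t n • c)]
  -- the x_n are bounded: far away `⟪w, c⟫ > M²/2 ≥ t_n M²/2`
  have hMpos : 0 < M := by
    have hZ := Real.sqrt_nonneg (∫ x, ‖curl w x‖ ^ 2)
    have hW := Real.sqrt_nonneg (∫ x, frobeniusNormSq (fderiv ℝ (curl w) x))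
    by_contra h
    rw [not_lt] at h
    have : M * Real.sqrt (∫ x, ‖curl w x‖ ^ 2) * Real.sqrt (∫ x, frobeniusNormSq (fderiv ℝ (curl w) x)) ≤ 0 :=
      mul_nonpos_of_nonpos_of_nonneg (mul_nonpos_of_nonpos_of_nonneg h hZ) hW
    linarith
  obtain ⟨R, hR⟩ := exists_radius_of_farLimit hlim (show 0 < M / 4 by positivity)
  have hxR : ∀ n, x n ∈ closedBall (0 : EuclideanSpace ℝ (Fin 3)) (max R 0) := by
    intro n
    rw [mem_closedBall, dist_zero_right]
    by_contra hfar
    rw [not_le] at hfar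
    have h := hR (x n) (lt_of_le_of_lt (le_max_left _ _) hfar)
    -- ⟪w x_n, c⟫ ≥ M² - ‖w x_n - c‖·M > M²/2
    have hlow : M ^ 2 - M * (M / 4) ≤ ⟪w (x n), c⟫ := by
      have e : ⟪w (x n), c⟫ = ⟪c, c⟫ + ⟪w (x n) - c, c⟫ := by rw [inner_sub_left]; ring
      rw [e, real_inner_self_eq_norm_sq, hcM]
      have hcs := abs_real_inner_le_norm (w (x n) - c) c
      rw [hcM] at hcs
      have := neg_abs_le ⟪w (x n) - c, c⟫
      nlinarith [norm_nonneg (w (x n) - c)]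
    have := hinner n
    have := hthalf n
    nlinarith
  -- extract a convergent subsequence
  obtain ⟨xs, -, φ, hφ, hconv⟩ := (isCompact_closedBall (0 : EuclideanSpace ℝ (Fin 3)) (max R 0)).tendsto_subseq hxR
  have htφ : Tendsto (fun n => t (φ n)) atTop (𝓝 0) := by
    have h0 : Tendsto t atTop (𝓝 0) := by
      rw [htdef]
      -- 1/(n+2) = (1/((n+1)+1))
      refine ((tendsto_one_div_add_atTop_nhds_zero_nat (𝕜 := ℝ)).comp (tendsto_add_atTop_nat 1)).congr fun n => ?_
      simp only [Function.comp]
      push_cast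
      ring
    exact h0.comp hφ.tendsto_atTop
  have hwconv : Tendsto (fun n => w (x (φ n))) atTop (𝓝 (w xs)) := (hw.continuous.tendsto xs).comp hconv
  refine ⟨xs, le_antisymm (hwM xs) ?_, ?_⟩
  · -- ‖w xs‖ ≥ M
    have hl : Tendsto (fun n => (1 - t (φ n)) * M) atTop (𝓝 ((1 - 0) * M)) :=
      ((tendsto_const_nhds.sub htφ).mul tendsto_const_nhds)
    rw [sub_zero, one_mul] at hl
    exact le_of_tendsto_of_tendsto' hl hwconv.norm fun n => hnorm (φ n)
  · -- ⟪w xs, c⟫ ≤ 0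
    have hl : Tendsto (fun n => t (φ n) * M ^ 2 / 2) atTop (𝓝 (0 * M ^ 2 / 2)) :=
      (htφ.mul tendsto_const_nhds).div_const 2
    rw [zero_mul, zero_div] at hl
    have hi : Tendsto (fun n => ⟪w (x (φ n)), c⟫) atTop (𝓝 ⟪w xs, c⟫) := hwconv.inner tendsto_const_nhds
    exact le_of_tendsto_of_tendsto' hi hl fun n => hinner (φ n)

end ExtremiserLiouville

end Summit.NavierStokesRegularity.NavierStokesRegularity.Theorems

end
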